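import Literature.Computability.AlgebraicComplexity.FlatteningBound
import HarnessLib

/-!
# `ω = 2` as an upper bound: equivalent forms of the matrix multiplication conjecture

Topic: `Literature/Computability/AlgebraicComplexity`; a theorems-only companion to
`MatrixMultiplicationExponent.lean` (the definitions `admissibleExponents`, `omega`, and the
conjectures `MatrixMultiplication := ω(ℂ) = 2`, `MatrixMultiplicationAllFields := ∀ K, ω(K) = 2`)
and `FlatteningBound.lean` (`omega_two_le : 2 ≤ ω(K)`, `admissibleExponents_bddBelow`).

## Content

* `mem_admissibleExponents_of_omega_lt` — every `β > ω(K)` is admissible (`ω` is the infimum of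
  an upward closed set; Bläser 2013, Def. 5.1); `omega_le_of_mem_admissibleExponents`.
* `omega_eq_two_iff_forall_pos` — `ω(K) = 2 ↔ ∀ ε > 0, R(⟨n,n,n⟩) = O(n^{2+ε})`: the usual reading
  of the conjecture (an infimum; no `O(n²)` bound is asserted), using `2 ≤ ω(K)`
  (`FlatteningBound.omega_two_le`, Bläser 2013, p. 19).
* `omega_eq_two_iff_omega_le_two`, `matrixMultiplication_iff_omega_le_two`,
  `matrixMultiplication_iff_forall_pos`, `matrixMultiplicationAllFields_iff_forall_omega_le_two`,
  `matrixMultiplicationAllFields_iff_forall_pos` — since the lower bound `2 ≤ ω(K)` is a theorem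
  for every field, both conjectures are exactly the UPPER bounds `ω ≤ 2`. That upper bound is an
  open problem (Bläser 2013, §9.2, p. 47: "If `R̃(CW) = q + 1`, then `ω = 2` would follow",
  Problem 9.8; §10.4, p. 55: Cohn et al. "make two conjectures, both of which would imply
  `ω = 2`"); nothing here proves or assumes it.

## References

* M. Bläser, *Fast Matrix Multiplication*, Theory of Computing Graduate Surveys 5 (2013),
  Def. 5.1 (p. 18), p. 19, §9.2 (p. 47, Problem 9.8), §10.4 (p. 55). [Blaser2013]
-/

noncomputable section

open Filter Asymptotics

namespace Literature.Computability.AlgebraicComplexity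

universe u

section Semiring

variable (K : Type u) [CommSemiring K]

/-- Every real number strictly above `ω(K)` is an admissible exponent: the admissible exponents
are upward closed (`mem_admissibleExponents_of_le`) and `ω(K)` is their infimum
(Bläser 2013, Def. 5.1). [cite: Blaser2013, Def. 5.1] -/
theorem mem_admissibleExponents_of_omega_lt {β : ℝ} (h : omega K < β) :
    β ∈ admissibleExponents K := by
  obtain ⟨γ, hγ, hγβ⟩ := exists_lt_of_csInf_lt (admissibleExponents_nonempty K) h
  exact mem_admissibleExponents_of_le K hγ hγβ.le

end Semiring

section Field

variable (K : Type u) [Field K]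

/-- `ω(K) ≤ β` for every admissible exponent `β` (the set is bounded below by `2`,
`admissibleExponents_bddBelow`). [cite: Blaser2013, Def. 5.1] -/
theorem omega_le_of_mem_admissibleExponents {β : ℝ} (hβ : β ∈ admissibleExponents K) :
    omega K ≤ β :=
  csInf_le (admissibleExponents_bddBelow K) hβ

/-- **What `ω = 2` says.** `ω(K) = 2` iff for every `ε > 0` the exponent `2 + ε` is admissible,
i.e. `R(⟨n,n,n⟩) = O(n^{2+ε})` (Bläser 2013, Def. 5.1: `ω` is an infimum, so no `O(n²)` bound is
asserted; the direction `←` uses the flattening bound `2 ≤ ω(K)`, Bläser 2013, p. 19).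
[cite: Blaser2013, Def. 5.1 and §5 (p. 19)] -/
theorem omega_eq_two_iff_forall_pos :
    omega K = 2 ↔ ∀ ε : ℝ, 0 < ε → (2 + ε) ∈ admissibleExponents K := by
  constructor
  · intro h ε hε
    exact mem_admissibleExponents_of_omega_lt K (by rw [h]; linarith)
  · intro h
    refine le_antisymm (le_of_forall_pos_lt_add fun ε hε => ?_) (omega_two_le K)
    have := omega_le_of_mem_admissibleExponents K (h (ε / 2) (by positivity))
    linarith

/-- Since `2 ≤ ω(K)` is a theorem (`omega_two_le`), `ω(K) = 2` is equivalent to the upper bound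
`ω(K) ≤ 2`. [cite: Blaser2013, Def. 5.1 and §5 (p. 19)] -/
theorem omega_eq_two_iff_omega_le_two : omega K = 2 ↔ omega K ≤ 2 :=
  ⟨fun h => h.le, fun h => le_antisymm h (omega_two_le K)⟩

end Field

/-! ## The conjectures restated as upper bounds -/

/-- The summit statement `MatrixMultiplication` (`ω(ℂ) = 2`) is equivalent to the upper bound
`ω(ℂ) ≤ 2`, the lower bound being the flattening theorem `omega_two_le`. The upper bound is open
(Bläser 2013, §9.2, p. 47: "If `R̃(CW) = q + 1`, then `ω = 2` would follow"; Problem 9.8).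
[cite: Blaser2013, Def. 5.1 and §9.2] -/
theorem matrixMultiplication_iff_omega_le_two : MatrixMultiplication ↔ omega ℂ ≤ 2 :=
  omega_eq_two_iff_omega_le_two ℂ

/-- `MatrixMultiplication` iff for every `ε > 0`, `R(⟨n,n,n⟩) = O(n^{2+ε})` over `ℂ`
(equivalently, by Bläser 2013, Thm. 5.2, `n × n` complex matrices can be multiplied with
`O(n^{2+ε})` arithmetic operations for every `ε > 0`). [cite: Blaser2013, Def. 5.1 and Thm. 5.2] -/
theorem matrixMultiplication_iff_forall_pos :
    MatrixMultiplication ↔ ∀ ε : ℝ, 0 < ε → (2 + ε) ∈ admissibleExponents ℂ :=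
  omega_eq_two_iff_forall_pos ℂ

/-- The all-fields conjecture `MatrixMultiplicationAllFields` (`ω(K) = 2` for every field `K`) is
equivalent to the upper bound `ω(K) ≤ 2` for every field, since `2 ≤ ω(K)` is a theorem
(`omega_two_le`). This upper bound is the open conjecture `ω = 2` (Bläser 2013, §9.2, Problem 9.8,
§10.4); it is not known whether `ω(K)` depends on (the characteristic of) `K`.
[cite: Blaser2013, Def. 5.1 and §9.2] -/
theorem matrixMultiplicationAllFields_iff_forall_omega_le_two :
    MatrixMultiplicationAllFields ↔ ∀ (K : Type) [Field K], omega K ≤ 2 :=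
  ⟨fun h K _ => (h K).le, fun h K _ => le_antisymm (h K) (omega_two_le K)⟩

/-- `MatrixMultiplicationAllFields` iff over every field and for every `ε > 0`,
`R(⟨n,n,n⟩) = O(n^{2+ε})`. [cite: Blaser2013, Def. 5.1 and §9.2] -/
theorem matrixMultiplicationAllFields_iff_forall_pos :
    MatrixMultiplicationAllFields ↔
      ∀ (K : Type) [Field K] (ε : ℝ), 0 < ε → (2 + ε) ∈ admissibleExponents K :=
  ⟨fun h K _ => (omega_eq_two_iff_forall_pos K).1 (h K),
    fun h K _ => (omega_eq_two_iff_forall_pos K).2 (h K)⟩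

end Literature.Computability.AlgebraicComplexity

end
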